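import Summits.ValiantsHypothesis.ValiantsHypothesis.Theorems.KPlusLogSqLawTridiagonalRealStaticUnitFourBlock

/-!
# Route «KPlusLogSqLaw», crux `WeakLifting` (stmt-ValiantsHypothesis-19561) — REAL side of the tridiagonal sector:
# the BLOCK DESCARTES LEMMA — `N` signed blocks of consecutive unit coefficients count like `N` monomials

HONEST FRAMING.  Helper theorems (`--supports stmt-ValiantsHypothesis-19561 --as helper`), seat val-sym-lift-p1 (g17), cell `pub-symmetroid`,
2026-08-28; Descartes bookkeeping for the unit-coefficient sub-sector of the α register, generalising the FOUR-BLOCK LEMMA of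
`…TridiagonalRealStaticUnitFourBlock` (p611773, the case `N = 4` of what follows) from four blocks to any number of blocks with any integer weights.
* **chain bound** (`altChain_length_le_of_blocks`): if `c(n) = Σ_{i<N} w_i·[p_i ≤ n < q_i]` (integer weights `w_i`, arbitrary integer intervals,
  overlaps allowed), then every chain `n_0 > n_1 > ⋯ > n_L` of exponents at which `c` is non-zero with strictly alternating signs has
  `L + 1 ≤ Σ_i |w_i|`.  Proof = discrete total variation: along the chain (padded by zeros at both ends) an alternating chain of `L + 1` non-zero
  INTEGERS costs variation `≥ 2L + 2`, while ONE block `[p ≤ n < q] = [p ≤ n] − [p ≤ n ∧ q ≤ n]` (difference of two monotone steps) contributes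
  variation `≤ 2` (`block_tv`, a telescoping sum), so the total is `≤ 2 Σ|w_i|`.
* **BLOCK DESCARTES LEMMA** (`signVariations_succ_le_of_blocks`, `card_posRoots_succ_le_of_blocks`): a non-zero real polynomial whose coefficient
  sequence is such a `c` has `Var + 1 ≤ Σ_i |w_i|`, hence at most `Σ_i |w_i| − 1` distinct positive roots (Descartes, Mathlib
  `roots_countP_pos_le_signVariations`); for unit weights `w_i = ±1`: `N` blocks ⇒ `Var ≤ N − 1`, exactly Descartes' count for `N` MONOMIALS
  (`signVariations_le_of_unitBlocks`, `card_posRoots_le_of_unitBlocks`, and the polynomial form `card_posRoots_le_of_sum_shiftedBlocks` for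
  `R = Σ_i ε_i X^{E_i}(1 + X + ⋯ + X^{k_i − 1})`).
* **`N` signed binomials** (`card_posRoots_le_of_sum_binomials`): `D = Σ_{i<N} ε_i (X^{A_i} − X^{B_i})` with `ε_i = ±1` has at most `N` distinct positive
  roots — `x = 1` and at most `N − 1` others — although it has up to `2N` monomials (Descartes alone: `2N − 1`).
The deflated unit determinants of the α register are of this shape (size `5`: four blocks, p612289); the lemma is the counting tool for deflations
with more blocks.  Nothing here is an upper law for the register (α NO MOVER); nothing bears on `WeakLifting` / `TropicalB` (stmt-19771) in their
windows, Conjecture B, the Door-A registers, `MatrixDescartes` (stmt-18050) or VP ≠ VNP.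
[this seat; folklore: Descartes' rule of signs; the total-variation reading of sign alternations]
-/

-- `Summit.ValiantsHypothesis.ValiantsHypothesis.…` repeats a component by the D-0017 layout (single-conjunct summit); the name is mandated.
set_option linter.dupNamespace false
set_option autoImplicit false

namespace Summit.ValiantsHypothesis.ValiantsHypothesis.Theorems.KPlusLogSqLaw
namespace StaticTridiagonalRealUnit

open Polynomial Finset

/-! ### A. One block has discrete total variation at most two along a monotone chain -/

/-- the indicator of the integer interval `[p, q)` as a difference of two MONOTONE steps: `[p ≤ n < q] = [p ≤ n] − [p ≤ n ∧ q ≤ n]`. [elementary] -/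
theorem blockInd_eq_step_sub_step (p q n : ℕ) :
    (if p ≤ n ∧ n < q then (1 : ℤ) else 0) = (if p ≤ n then (1 : ℤ) else 0) - (if p ≤ n ∧ q ≤ n then (1 : ℤ) else 0) := by
  by_cases h1 : p ≤ n <;> by_cases h2 : n < q
  · rw [if_pos ⟨h1, h2⟩, if_pos h1, if_neg (fun h => absurd h.2 (by omega))]; ring
  · rw [if_neg (fun h => h2 h.2), if_pos h1, if_pos ⟨h1, by omega⟩]; ring
  · rw [if_neg (fun h => h1 h.1), if_neg h1, if_neg (fun h => h1 h.1)]; ring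
  · rw [if_neg (fun h => h1 h.1), if_neg h1, if_neg (fun h => h1 h.1)]; ring

/-- **one block has total variation at most `2` along a chain**: for a strictly decreasing chain `a 0 > a 1 > ⋯ > a L` of exponents,
`[a 0 ∈ I] + Σ_{j<L} |[a (j+1) ∈ I] − [a j ∈ I]| + [a L ∈ I] ≤ 2` for every integer interval `I = [p, q)` (telescoping of the two monotone steps).
[elementary] -/
theorem block_tv (p q : ℕ) (a : ℕ → ℕ) (L : ℕ) (ha : ∀ j, j < L → a (j + 1) < a j) :
    (if p ≤ a 0 ∧ a 0 < q then (1 : ℤ) else 0) +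
        ∑ j ∈ range L, |(if p ≤ a (j + 1) ∧ a (j + 1) < q then (1 : ℤ) else 0) - (if p ≤ a j ∧ a j < q then (1 : ℤ) else 0)| +
        (if p ≤ a L ∧ a L < q then (1 : ℤ) else 0) ≤ 2 := by
  set g : ℕ → ℤ := fun n => if p ≤ n then 1 else 0 with hg
  set h : ℕ → ℤ := fun n => if p ≤ n ∧ q ≤ n then 1 else 0 with hh
  have hind : ∀ n, (if p ≤ n ∧ n < q then (1 : ℤ) else 0) = g n - h n := fun n => blockInd_eq_step_sub_step p q n
  have gmono : ∀ x y : ℕ, x ≤ y → g x ≤ g y := by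
    intro x y hxy; simp only [hg]; split_ifs <;> omega
  have hmono : ∀ x y : ℕ, x ≤ y → h x ≤ h y := by
    intro x y hxy; simp only [hh]; split_ifs <;> omega
  have step : ∀ j ∈ range L, |(g (a (j + 1)) - h (a (j + 1))) - (g (a j) - h (a j))| ≤
      (g (a j) - g (a (j + 1))) + (h (a j) - h (a (j + 1))) := by
    intro j hj
    have h1 := gmono _ _ (ha j (mem_range.1 hj)).le
    have h2 := hmono _ _ (ha j (mem_range.1 hj)).le
    rw [abs_le]; constructor <;> linarith
  have tele : ∑ j ∈ range L, ((g (a j) - g (a (j + 1))) + (h (a j) - h (a (j + 1)))) =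
      (g (a 0) - g (a L)) + (h (a 0) - h (a L)) := by
    have t1 := Finset.sum_range_sub (fun j => g (a j)) L
    have t2 := Finset.sum_range_sub (fun j => h (a j)) L
    have e : ∀ j, (g (a j) - g (a (j + 1))) + (h (a j) - h (a (j + 1))) =
        -((g (a (j + 1)) - g (a j)) + (h (a (j + 1)) - h (a j))) := fun j => by ring
    simp_rw [e]
    rw [Finset.sum_neg_distrib, Finset.sum_add_distrib, t1, t2]; ring
  simp_rw [hind]
  have hsum : ∑ j ∈ range L, |(g (a (j + 1)) - h (a (j + 1))) - (g (a j) - h (a j))| ≤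
      (g (a 0) - g (a L)) + (h (a 0) - h (a L)) := by
    rw [← tele]; exact Finset.sum_le_sum step
  have g1 : g (a 0) ≤ 1 := by simp only [hg]; split_ifs <;> omega
  have h0 : 0 ≤ h (a L) := by simp only [hh]; split_ifs <;> omega
  have hg0 : h (a 0) ≤ g (a 0) := by simp only [hg, hh]; split_ifs <;> omega
  have hgL : h (a L) ≤ g (a L) := by simp only [hg, hh]; split_ifs <;> omega
  linarith

/-! ### B. The chain bound: an alternating chain of a weighted block sequence is no longer than the total weight -/

/-- **chain bound.**  If `c(n) = Σ_{i<N} w_i·[p_i ≤ n < q_i]` with integer weights, then a strictly decreasing chain of exponents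
`a 0 > ⋯ > a L` at which `c` is non-zero with strictly alternating signs has `L + 1 ≤ Σ_i |w_i|` (discrete total variation: the chain costs
`≥ 2L + 2`, each block pays `≤ 2|w_i|`). [this file; folklore technique] -/
theorem altChain_length_le_of_blocks (N : ℕ) (w : ℕ → ℤ) (p q : ℕ → ℕ) (c : ℕ → ℤ)
    (hc : ∀ n, c n = ∑ i ∈ range N, w i * (if p i ≤ n ∧ n < q i then 1 else 0))
    (L : ℕ) (a : ℕ → ℕ) (ha : ∀ j, j < L → a (j + 1) < a j)
    (h0 : c (a 0) ≠ 0) (hL : c (a L) ≠ 0) (halt : ∀ j, j < L → c (a j) * c (a (j + 1)) < 0) :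
    (L : ℤ) + 1 ≤ ∑ i ∈ range N, |w i| := by
  -- lower bound on the variation of `c` along the padded chain
  have low : 2 * (L : ℤ) + 2 ≤ |c (a 0)| + ∑ j ∈ range L, |c (a (j + 1)) - c (a j)| + |c (a L)| := by
    have e1 : 1 ≤ |c (a 0)| := Int.one_le_abs h0
    have e2 : 1 ≤ |c (a L)| := Int.one_le_abs hL
    have e3 : ∀ j ∈ range L, (2 : ℤ) ≤ |c (a (j + 1)) - c (a j)| := by
      intro j hj
      have hlt := halt j (mem_range.1 hj)
      rcases lt_trichotomy (c (a j)) 0 with h1 | h1 | h1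
      · have h2 : 0 < c (a (j + 1)) := by
          by_contra h2; push Not at h2; nlinarith
        rw [abs_of_pos (by omega)]; omega
      · rw [h1, zero_mul] at hlt; exact absurd hlt (lt_irrefl 0)
      · have h2 : c (a (j + 1)) < 0 := by
          by_contra h2; push Not at h2; nlinarith
        rw [abs_of_neg (by omega)]; omega
    have e4 := Finset.sum_le_sum e3
    simp only [sum_const, card_range, nsmul_eq_mul] at e4
    linarith
  -- upper bound: triangle inequality block by block, then `block_tv`
  have A : ∀ n, |c n| ≤ ∑ i ∈ range N, |w i| * (if p i ≤ n ∧ n < q i then (1 : ℤ) else 0) := by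
    intro n; rw [hc n]
    refine (abs_sum_le_sum_abs _ _).trans (le_of_eq (sum_congr rfl fun i _ => ?_))
    rw [abs_mul]
    congr 1
    split_ifs <;> simp
  have B : ∀ j, |c (a (j + 1)) - c (a j)| ≤ ∑ i ∈ range N, |w i| *
      |(if p i ≤ a (j + 1) ∧ a (j + 1) < q i then (1 : ℤ) else 0) - (if p i ≤ a j ∧ a j < q i then (1 : ℤ) else 0)| := by
    intro j; rw [hc, hc, ← sum_sub_distrib]
    refine (abs_sum_le_sum_abs _ _).trans (le_of_eq (sum_congr rfl fun i _ => ?_))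
    rw [← mul_sub, abs_mul]
  have up : |c (a 0)| + ∑ j ∈ range L, |c (a (j + 1)) - c (a j)| + |c (a L)| ≤ 2 * ∑ i ∈ range N, |w i| := by
    calc |c (a 0)| + ∑ j ∈ range L, |c (a (j + 1)) - c (a j)| + |c (a L)|
        ≤ ∑ i ∈ range N, |w i| * (if p i ≤ a 0 ∧ a 0 < q i then (1 : ℤ) else 0) +
            ∑ j ∈ range L, ∑ i ∈ range N, |w i| *
              |(if p i ≤ a (j + 1) ∧ a (j + 1) < q i then (1 : ℤ) else 0) - (if p i ≤ a j ∧ a j < q i then (1 : ℤ) else 0)| +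
            ∑ i ∈ range N, |w i| * (if p i ≤ a L ∧ a L < q i then (1 : ℤ) else 0) :=
          add_le_add_three (A _) (Finset.sum_le_sum fun j _ => B j) (A _)
      _ = ∑ i ∈ range N, |w i| * ((if p i ≤ a 0 ∧ a 0 < q i then (1 : ℤ) else 0) +
            ∑ j ∈ range L,
              |(if p i ≤ a (j + 1) ∧ a (j + 1) < q i then (1 : ℤ) else 0) - (if p i ≤ a j ∧ a j < q i then (1 : ℤ) else 0)| +
            (if p i ≤ a L ∧ a L < q i then (1 : ℤ) else 0)) := by
          rw [Finset.sum_comm]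
          simp only [mul_add, Finset.sum_add_distrib, Finset.mul_sum]
      _ ≤ ∑ i ∈ range N, |w i| * 2 :=
          Finset.sum_le_sum fun i _ => mul_le_mul_of_nonneg_left (block_tv (p i) (q i) a L ha) (abs_nonneg _)
      _ = 2 * ∑ i ∈ range N, |w i| := by rw [← Finset.sum_mul]; ring
  linarith

/-! ### C. The block Descartes lemma for real polynomials -/

/-- **BLOCK DESCARTES LEMMA (weighted form).**  A non-zero real polynomial whose coefficient sequence is `Σ_{i<N} w_i·[p_i ≤ n < q_i]` (integer
weights, arbitrary integer intervals) has `Var + 1 ≤ Σ_i |w_i|`. [this file] -/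
theorem signVariations_succ_le_of_blocks (R : ℝ[X]) (hR0 : R ≠ 0) (N : ℕ) (w : ℕ → ℤ) (p q : ℕ → ℕ)
    (hR : ∀ n, R.coeff n = ∑ i ∈ range N, (w i : ℝ) * (if p i ≤ n ∧ n < q i then 1 else 0)) :
    R.signVariations + 1 ≤ ∑ i ∈ range N, (w i).natAbs := by
  set c : ℕ → ℤ := fun n => ∑ i ∈ range N, w i * (if p i ≤ n ∧ n < q i then 1 else 0) with hcdef
  have hRc : ∀ n, R.coeff n = (c n : ℝ) := by
    intro n; rw [hR n, hcdef]; push_cast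
    refine sum_congr rfl fun i _ => ?_
    split_ifs <;> simp
  obtain ⟨idx, hmono, -, hsgn⟩ := exists_altChain_of_le_signVariations hR0 (le_refl R.signVariations)
  have hlc : R.leadingCoeff ≠ 0 := leadingCoeff_ne_zero.2 hR0
  have hl2 : 0 < R.leadingCoeff * R.leadingCoeff := mul_self_pos.2 hlc
  -- non-vanishing at the two ends of the chain
  have hne : ∀ j, j ≤ R.signVariations → c (idx j) ≠ 0 := by
    intro j hj h0
    have g := hsgn j hj
    rw [hRc, h0, Int.cast_zero, mul_zero, mul_zero] at g
    exact lt_irrefl _ g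
  -- consecutive members have opposite signs
  have halt : ∀ j, j < R.signVariations → c (idx j) * c (idx (j + 1)) < 0 := by
    intro j hj
    have g1 := hsgn j hj.le
    have g2 := hsgn (j + 1) hj
    rw [hRc] at g1 g2
    have g3 : 0 < ((-1 : ℝ) ^ j * (R.leadingCoeff * (c (idx j) : ℝ))) * ((-1 : ℝ) ^ (j + 1) * (R.leadingCoeff * (c (idx (j + 1)) : ℝ))) :=
      mul_pos g1 g2
    have e : ((-1 : ℝ) ^ j * (R.leadingCoeff * (c (idx j) : ℝ))) * ((-1 : ℝ) ^ (j + 1) * (R.leadingCoeff * (c (idx (j + 1)) : ℝ))) =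
        -(((-1 : ℝ) ^ j) ^ 2 * (R.leadingCoeff * R.leadingCoeff) * ((c (idx j) : ℝ) * (c (idx (j + 1)) : ℝ))) := by
      rw [pow_succ]; ring
    rw [e] at g3
    have hsq : 0 < ((-1 : ℝ) ^ j) ^ 2 := by positivity
    have g4 : ((c (idx j) : ℝ) * (c (idx (j + 1)) : ℝ)) < 0 := by
      by_contra g4; push Not at g4
      have := mul_nonneg (mul_pos hsq hl2).le g4
      linarith
    exact_mod_cast g4
  have main := altChain_length_le_of_blocks N w p q c (fun n => rfl) R.signVariations idx hmono
    (hne 0 (Nat.zero_le _)) (hne _ le_rfl) halt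
  have hcast : (∑ i ∈ range N, |w i|) = ((∑ i ∈ range N, (w i).natAbs : ℕ) : ℤ) := by
    simp [Nat.cast_sum]
  rw [hcast] at main
  exact_mod_cast main

/-- **at most `Σ|w_i| − 1` positive roots** for a non-zero polynomial with a weighted block coefficient sequence (Descartes). [this file] -/
theorem card_posRoots_succ_le_of_blocks (R : ℝ[X]) (hR0 : R ≠ 0) (N : ℕ) (w : ℕ → ℤ) (p q : ℕ → ℕ)
    (hR : ∀ n, R.coeff n = ∑ i ∈ range N, (w i : ℝ) * (if p i ≤ n ∧ n < q i then 1 else 0)) :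
    (R.roots.toFinset.filter (fun x => 0 < x)).card + 1 ≤ ∑ i ∈ range N, (w i).natAbs := by
  have hV := signVariations_succ_le_of_blocks R hR0 N w p q hR
  have hcount : R.roots.countP (fun x => 0 < x) ≤ R.signVariations := R.roots_countP_pos_le_signVariations
  have hcard : (R.roots.toFinset.filter (fun x => 0 < x)).card ≤ R.roots.countP (fun x => 0 < x) := by
    rw [← Multiset.toFinset_filter, Multiset.countP_eq_card_filter]
    exact Multiset.toFinset_card_le _
  omega

/-- **BLOCK DESCARTES LEMMA (unit form): `N` signed unit blocks ⇒ `Var ≤ N − 1`** — blocks of consecutive unit coefficients count like single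
monomials in Descartes' bound. [this file] -/
theorem signVariations_le_of_unitBlocks (R : ℝ[X]) (N : ℕ) (w : ℕ → ℤ) (p q : ℕ → ℕ)
    (hw : ∀ i, i < N → w i = 1 ∨ w i = -1)
    (hR : ∀ n, R.coeff n = ∑ i ∈ range N, (w i : ℝ) * (if p i ≤ n ∧ n < q i then 1 else 0)) :
    R.signVariations ≤ N - 1 := by
  by_cases hR0 : R = 0
  · rw [hR0, signVariations_zero]; exact Nat.zero_le _
  have h := signVariations_succ_le_of_blocks R hR0 N w p q hR
  have hN : ∑ i ∈ range N, (w i).natAbs = N := by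
    rw [Finset.sum_congr rfl (fun i hi => show (w i).natAbs = 1 from by
      rcases hw i (mem_range.1 hi) with h1 | h1 <;> simp [h1])]
    simp
  omega

/-- **unit form, roots: `N` signed unit blocks ⇒ at most `N − 1` distinct positive roots.** [this file] -/
theorem card_posRoots_le_of_unitBlocks (R : ℝ[X]) (N : ℕ) (w : ℕ → ℤ) (p q : ℕ → ℕ)
    (hw : ∀ i, i < N → w i = 1 ∨ w i = -1)
    (hR : ∀ n, R.coeff n = ∑ i ∈ range N, (w i : ℝ) * (if p i ≤ n ∧ n < q i then 1 else 0)) :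
    (R.roots.toFinset.filter (fun x => 0 < x)).card ≤ N - 1 := by
  by_cases hR0 : R = 0
  · rw [hR0, roots_zero]; simp
  have h := card_posRoots_succ_le_of_blocks R hR0 N w p q hR
  have hN : ∑ i ∈ range N, (w i).natAbs = N := by
    rw [Finset.sum_congr rfl (fun i hi => show (w i).natAbs = 1 from by
      rcases hw i (mem_range.1 hi) with h1 | h1 <;> simp [h1])]
    simp
  omega

/-! ### D. Polynomial forms: shifted blocks `X^E (1 + X + ⋯ + X^{k−1})` and signed binomials `X^A − X^B` -/

/-- coefficients of a weighted sum of shifted blocks. [elementary] -/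
theorem coeff_sum_shiftedBlocks (N : ℕ) (w : ℕ → ℤ) (E k : ℕ → ℕ) (n : ℕ) :
    (∑ i ∈ range N, C ((w i : ℤ) : ℝ) * ((X : ℝ[X]) ^ E i * ∑ t ∈ range (k i), (X : ℝ[X]) ^ t)).coeff n =
      ∑ i ∈ range N, (w i : ℝ) * (if E i ≤ n ∧ n < E i + k i then 1 else 0) := by
  rw [finsetSum_coeff]
  refine sum_congr rfl fun i _ => ?_
  rw [coeff_C_mul, coeff_X_pow_mul_geom_sum]

/-- **`N` shifted unit blocks have at most `N − 1` positive roots**: `R = Σ_{i<N} ε_i · X^{E_i}(1 + X + ⋯ + X^{k_i−1})`, `ε_i = ±1`, arbitrary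
shifts and lengths (overlaps allowed). [this file] -/
theorem card_posRoots_le_of_sum_shiftedBlocks (N : ℕ) (w : ℕ → ℤ) (E k : ℕ → ℕ) (hw : ∀ i, i < N → w i = 1 ∨ w i = -1)
    (R : ℝ[X]) (hR : R = ∑ i ∈ range N, C ((w i : ℤ) : ℝ) * ((X : ℝ[X]) ^ E i * ∑ t ∈ range (k i), (X : ℝ[X]) ^ t)) :
    (R.roots.toFinset.filter (fun x => 0 < x)).card ≤ N - 1 :=
  card_posRoots_le_of_unitBlocks R N w E (fun i => E i + k i) hw (fun n => by rw [hR]; exact coeff_sum_shiftedBlocks N w E k n)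

/-- a signed binomial is `X − 1` times a signed shifted block:
`ε (X^A − X^B) = (X − 1) · (ε' X^{min(A,B)} (1 + ⋯ + X^{|A−B|−1}))` with `ε' = ε` if `B ≤ A` and `ε' = −ε` otherwise. [elementary] -/
theorem binomial_eq_X_sub_one_mul (ε : ℤ) (A B : ℕ) :
    C ((ε : ℤ) : ℝ) * ((X : ℝ[X]) ^ A - X ^ B) =
      (X - C 1) * (C (((if B ≤ A then ε else -ε : ℤ) : ℤ) : ℝ) *
        ((X : ℝ[X]) ^ min A B * ∑ t ∈ range (A - B + (B - A)), (X : ℝ[X]) ^ t)) := by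
  have key : ∀ m d : ℕ, (X - C (1 : ℝ)) * ((X : ℝ[X]) ^ m * ∑ t ∈ range d, (X : ℝ[X]) ^ t) = X ^ (m + d) - X ^ m := by
    intro m d
    have g := geom_sum_mul (X : ℝ[X]) d
    rw [map_one, pow_add]
    calc (X - 1) * ((X : ℝ[X]) ^ m * ∑ t ∈ range d, (X : ℝ[X]) ^ t)
        = X ^ m * ((∑ t ∈ range d, (X : ℝ[X]) ^ t) * (X - 1)) := by ring
      _ = X ^ m * (X ^ d - 1) := by rw [g]
      _ = X ^ m * X ^ d - X ^ m := by ring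
  by_cases hBA : B ≤ A
  · rw [if_pos hBA, min_eq_right hBA, show A - B + (B - A) = A - B by omega, mul_left_comm, key,
      show B + (A - B) = A by omega]
  · rw [if_neg hBA, min_eq_left (by omega), show A - B + (B - A) = B - A by omega, mul_left_comm, key,
      show A + (B - A) = B by omega]
    push_cast
    rw [C_neg]; ring

/-- **`N` SIGNED BINOMIALS HAVE AT MOST `N` POSITIVE ROOTS**: `D = Σ_{i<N} ε_i (X^{A_i} − X^{B_i})`, `ε_i = ±1`, has at most `N` distinct positive
roots (`x = 1` and at most `N − 1` others), although it carries up to `2N` monomials. [this file] -/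
theorem card_posRoots_le_of_sum_binomials (N : ℕ) (w : ℕ → ℤ) (A B : ℕ → ℕ) (hw : ∀ i, i < N → w i = 1 ∨ w i = -1)
    (D : ℝ[X]) (hD : D = ∑ i ∈ range N, C ((w i : ℤ) : ℝ) * ((X : ℝ[X]) ^ A i - X ^ B i)) :
    (D.roots.toFinset.filter (fun x => 0 < x)).card ≤ N := by
  set w' : ℕ → ℤ := fun i => if B i ≤ A i then w i else -w i with hw'
  set R : ℝ[X] := ∑ i ∈ range N, C ((w' i : ℤ) : ℝ) *
    ((X : ℝ[X]) ^ min (A i) (B i) * ∑ t ∈ range (A i - B i + (B i - A i)), (X : ℝ[X]) ^ t) with hRdef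
  have hDR : D = (X - C 1) * R := by
    rw [hD, hRdef, Finset.mul_sum]
    refine sum_congr rfl fun i _ => ?_
    rw [binomial_eq_X_sub_one_mul]
  have hw'u : ∀ i, i < N → w' i = 1 ∨ w' i = -1 := by
    intro i hi; simp only [hw']
    rcases hw i hi with h | h <;> split_ifs <;> simp [h]
  have hR := card_posRoots_le_of_sum_shiftedBlocks N w' (fun i => min (A i) (B i)) (fun i => A i - B i + (B i - A i)) hw'u R hRdef
  by_cases hD0 : D = 0
  · rw [hD0, roots_zero]; simp
  have hX1 : (X - C (1 : ℝ)) * R ≠ 0 := by rw [← hDR]; exact hD0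
  have hsub : D.roots.toFinset.filter (fun x => 0 < x) ⊆ insert 1 (R.roots.toFinset.filter (fun x => 0 < x)) := by
    intro x hx
    simp only [Finset.mem_filter, Multiset.mem_toFinset] at hx
    rw [hDR, roots_mul hX1, roots_X_sub_C, Multiset.mem_add, Multiset.mem_singleton] at hx
    rcases hx.1 with h1 | h1
    · rw [h1]; exact Finset.mem_insert_self _ _
    · exact Finset.mem_insert_of_mem (Finset.mem_filter.2 ⟨Multiset.mem_toFinset.2 h1, hx.2⟩)
  have hN : 1 ≤ N := by
    by_contra hN
    apply hD0
    rw [hD, show N = 0 by omega, Finset.range_zero, Finset.sum_empty]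
  exact (Finset.card_le_card hsub).trans ((Finset.card_insert_le _ _).trans (by omega))

end StaticTridiagonalRealUnit
end Summit.ValiantsHypothesis.ValiantsHypothesis.Theorems.KPlusLogSqLaw
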